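import Literature.AlgebraicGeometry.Resolution.ZariskiPatchingGlue
import Literature.AlgebraicGeometry.Resolution.ResolutionProjectiveReduction
import Literature.AlgebraicGeometry.Resolution.AlterationsStrong
import Literature.AlgebraicGeometry.Resolution.LocalUniformization
import Mathlib.RingTheory.EssentialFiniteness
import HarnessLib

/-!
# Zariski's patching programme in every dimension: resolution from relative local
# uniformization and the patching of two projective models

Topic: `Literature/AlgebraicGeometry/Resolution`. `ZariskiPatchingGlue.lean` proves the reduction
of `CossartPiltant2019Patching` (dimension `3`) to the patching of two projective models
(Zariski 1944, Fundamental Theorem p. 539; Piltant 2013, Prop. 5.1 with `P = P_reg`). Nothing in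
that reduction is three-dimensional except the local-uniformization input `LocalUniformization3`:
this file records the DIMENSION-FREE form, with relative local uniformization of every valuation
ring (the shape `RelLocalUniformization` of `RankOneReduction.lean`, written universe
polymorphically inline) in place of `LocalUniformization3`. All proofs are those of
`ZariskiPatchingGlue.lean` with the transcendence-degree bookkeeping deleted.

* `exists_hasRegularCentre_of_relLU` — relative LU uniformizes every valuation of `K/k` on a
  finitely generated affine MODEL (`Frac T = K`).
* `hasResolution_of_twoModelPatching_of_relLU` — for an integral closed subscheme `X ⊆ ℙⁿ_k`
  (any dimension): two-model patching for all function fields over `k` + relative LU over `k`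
  ⇒ `Scheme.HasResolution X` (finite resolving system by Zariski's compactness theorem, then
  patch two at a time, Piltant 2013, Cor. 5.7).
* `resolutionOverUpToDim_of_twoModelPatching_of_relLU` — hence weak resolution of every reduced
  separated `k`-scheme of finite type (components + Chow + projective closure,
  `ResolutionOverUpToDim.of_projective`), in every dimension.
* `hasResolution_of_twoModelPatching_of_uniformizable`, `exists_hasRegularCentre_of_lu`,
  `resolutionInChar_of_twoModelPatching_of_lu` — the resolving-system step consumes only
  ABSOLUTE local uniformization (Piltant's Axiom 5): `LocalUniformizationInChar p` + two-model
  patching ⇒ `ResolutionInChar.{0} p` as well, so the relative antecedent of `PatchingRel` and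
  the absolute one of the superseded crux `Patching` (stmt-0561) reduce to the same open core.
* `resolutionInChar_of_twoModelPatching_of_relLU` — hence, in characteristic `p`: two-model
  patching over all fields of characteristic `p` + relative LU in characteristic `p` ⇒
  `ResolutionInChar.{0} p`. This isolates what the crux `PatchingRel` (route `Valuative`,
  stmt-ResolutionOfSingularities-0642: `LUrel_p → ResolutionInChar p`) needs beyond its
  antecedent: exactly Piltant's Prop. 5.1 for `P = P_reg` in dimension `≥ 4` ("All of these
  problems are open in dimension four or more", Piltant 2013, p. 2).

## References

* O. Zariski, *Reduction of the singularities of algebraic three dimensional varieties*, Ann.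
  of Math. 45 (1944) 472–542, Fundamental Theorem p. 539.
* O. Zariski, P. Samuel, *Commutative Algebra* II, Ch. VI §17. [ZariskiSamuel1960]
* O. Piltant, *An axiomatic version of Zariski's patching theorem*, RACSAM 107 (2013) 91–121,
  p. 2, Prop. 5.1, Cor. 5.7. [Piltant2013]
* V. Cossart, O. Piltant, J. Algebra 529 (2019), proof of Prop. 4.6, Steps 1–3
  (arXiv:1412.0868v1: Prop. 4.4). [CossartPiltant2019]
-/

noncomputable section

open CategoryTheory AlgebraicGeometry TopologicalSpace IsLocalRing

namespace Literature.AlgebraicGeometry.Resolution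

universe u

/-- **Relative local uniformization uniformizes every valuation of a function field on a finitely
generated affine model** (`T ⊆ 𝒪_v` with `Frac T = K`, regular at the centre): apply it to an
affine model of `K` inside `𝒪_v` (`exists_fg_le_valuationSubring`). Dimension-free form of
`LocalUniformization3.exists_hasRegularCentre`. [cite: ZariskiSamuel1960, Ch. VI §17] -/
theorem exists_hasRegularCentre_of_relLU {k K : Type u} [Field k] [Field K] [Algebra k K]
    (hLU : ∀ (O : ValuationSubring K) (R : Subalgebra k K), R.FG → IsFractionRing R K →
      R.toSubring ≤ O.toSubring → ∃ (A : Subalgebra k K) (h : A.toSubring ≤ O.toSubring),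
        R ≤ A ∧ A.FG ∧ IsRegularLocalRing (Localization.AtPrime
          (Ideal.comap (Subring.inclusion h) (IsLocalRing.maximalIdeal O))))
    (A₀ : Subalgebra k K) (h0 : A₀.FG) [IsFractionRing A₀ K] (v : ZariskiRiemannSpace k K) :
    ∃ T : Subalgebra k K, (T.FG ∧ IsFractionRing T K) ∧
      ZariskiRiemannSpace.HasRegularCentre T v := by
  obtain ⟨A, hAfg, hAO, hAfr⟩ :=
    exists_fg_le_valuationSubring A₀ h0 v.asValuationSubring v.algebraMap_mem
  haveI := hAfr
  obtain ⟨T, hTO, hle, hTfg, hreg⟩ := hLU v.asValuationSubring A hAfg hAfr hAO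
  exact ⟨T, ⟨hTfg, isFractionRing_of_le hle hAfr⟩, hTO, hreg⟩

/-- **Resolution of an integral projective variety of ANY dimension from relative local
uniformization and the patching of two projective models** (Zariski 1944; Piltant 2013, Prop. 5.1
and Cor. 5.7; Cossart–Piltant 2019, proof of Prop. 4.6, Steps 1 and 3 — there for threefolds;
the argument is dimension-free once (LU) is): for an integral closed subscheme `X ⊆ ℙⁿ_k`,
relative LU over `k` and two-model patching for function fields over `k` give
`Scheme.HasResolution X`. Proof verbatim that of `hasResolution_of_twoModelPatching_of_dim_three`.
[cite: Piltant2013, Prop. 5.1 and Cor. 5.7] -/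
theorem hasResolution_of_twoModelPatching_of_relLU {k : Type u} [Field k]
    (hZ : ∀ (K : Type u) [Field K] [Algebra k K] [Algebra.EssFiniteType k K],
      ∀ M₁ M₂ : ProjModel k K,
        ∃ (N : ProjModel k K) (φ₁ : N.Hom M₁) (φ₂ : N.Hom M₂), φ₁.RegLe ∧ φ₂.RegLe)
    (hLU : ∀ (K : Type u) [Field K] [Algebra k K] (O : ValuationSubring K) (R : Subalgebra k K),
      R.FG → IsFractionRing R K → R.toSubring ≤ O.toSubring →
        ∃ (A : Subalgebra k K) (h : A.toSubring ≤ O.toSubring), R ≤ A ∧ A.FG ∧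
          IsRegularLocalRing (Localization.AtPrime
            (Ideal.comap (Subring.inclusion h) (IsLocalRing.maximalIdeal O))))
    {n : ℕ} (X : Scheme.{u}) [IsIntegral X]
    (ι : X ⟶ (Motives.projectiveSpace n k).left) [IsClosedImmersion ι] :
    Scheme.HasResolution X := by
  classical
  haveI : IsProper (Motives.projectiveSpace n k).hom := Motives.isProper_projectiveSpace n k
  let πX : X ⟶ Spec (.of k) := ι ≫ (Motives.projectiveSpace n k).hom
  have hproj : Motives.IsProjectiveOver (Over.mk πX) := ⟨n, Over.homMk ι rfl, ‹_›⟩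
  haveI : LocallyOfFiniteType πX := inferInstance
  -- an affine chart `U = Spec A` of `X`
  obtain ⟨_, ⟨U', hU', rfl⟩, hηU, -⟩ := X.isBasis_affineOpens.exists_subset_of_mem_open
    (Set.mem_univ (genericPoint X)) isOpen_univ
  let U : X.Opens := U'
  have hU : IsAffineOpen U := hU'
  haveI : IsAffine U := hU
  haveI : Nonempty U := ⟨⟨_, hηU⟩⟩
  let A : Type u := Γ(U, ⊤)
  -- `A` is a finitely generated `k`-algebra
  let g : (U : Scheme.{u}) ⟶ Spec (.of k) := U.ι ≫ πX
  let ψ : k →+* A := g.appTop.hom.comp (Scheme.ΓSpecIso (.of k)).inv.hom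
  have hψ : ψ.FiniteType := by
    have h1 : g.appTop.hom.FiniteType :=
      (HasRingHomProperty.iff_of_isAffine (P := @LocallyOfFiniteType)).mp inferInstance
    exact h1.comp (RingHom.FiniteType.of_surjective _
      (Scheme.ΓSpecIso (.of k)).symm.commRingCatIsoToRingEquiv.surjective)
  letI : Algebra k A := ψ.toAlgebra
  haveI hft : Algebra.FiniteType k A := hψ
  -- its fraction field `K`, and `X` as a projective model of `K/k`
  let K : Type u := FractionRing A
  let j : Spec (.of A) ⟶ X := U.toScheme.isoSpec.inv ≫ U.ι
  have hj : j ≫ πX = Spec.map (CommRingCat.ofHom (algebraMap k A)) := by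
    change (U.toScheme.isoSpec.inv ≫ U.ι) ≫ πX = Spec.map (CommRingCat.ofHom ψ)
    rw [Category.assoc, isoSpec_inv_comp]
    rfl
  let M₀ : ProjModel k K := ProjModel.ofChart (K := K) X πX hproj A j hj
  -- `A` as a subalgebra `A₀ ⊆ K`, finitely generated with `Frac A₀ = K`
  let toK : A →ₐ[k] K := IsScalarTower.toAlgHom k A K
  have htoK : Function.Injective toK := IsFractionRing.injective A K
  let A₀ : Subalgebra k K := toK.range
  have hA₀fg : A₀.FG := by
    rw [show A₀ = Subalgebra.map toK ⊤ from (Algebra.map_top toK).symm]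
    exact Subalgebra.FG.map toK hft.out
  haveI hA₀fr : IsFractionRing A₀ K := by
    refine IsFractionRing.of_field A₀ K fun z => ?_
    obtain ⟨a, b, -, rfl⟩ := IsFractionRing.div_surjective (A := A) z
    exact ⟨⟨algebraMap A K a, a, rfl⟩, ⟨algebraMap A K b, b, rfl⟩, rfl⟩
  -- a finite resolving system of affine models, from (LU)
  have hcov : ∀ v : ZariskiRiemannSpace k K, ∃ T : Subalgebra k K,
      (T.FG ∧ IsFractionRing T K) ∧ ZariskiRiemannSpace.HasRegularCentre T v :=
    fun v => exists_hasRegularCentre_of_relLU (hLU K) A₀ hA₀fg v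
  obtain ⟨𝒯, h𝒯, h𝒯cov⟩ := exists_finite_resolvingSystem' (P := fun T => IsFractionRing T K)
    (fun T hT => (isJ2Ring_of_field k).2 T ((Subalgebra.fg_iff_finiteType T).mp hT)) hcov
  -- their projective closures: a finite resolving system of projective models
  have hM : ∀ T : ↥𝒯, ∃ M : ProjModel k K, ∀ w : ZariskiRiemannSpace k K,
      ZariskiRiemannSpace.HasRegularCentre T.1 w → M.RegCentre w := fun T => by
    haveI := (h𝒯 T.1 T.2).2
    exact ProjModel.exists_regCentre_of_hasRegularCentre T.1 (h𝒯 T.1 T.2).1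
  choose M hM using hM
  let l : List (ProjModel k K) := 𝒯.attach.toList.map M
  have hlcov : ∀ v : ZariskiRiemannSpace k K, ∃ N ∈ l, N.RegCentre v := by
    intro v
    obtain ⟨T, hT, hTv⟩ := h𝒯cov v
    refine ⟨M ⟨T, hT⟩, ?_, hM ⟨T, hT⟩ v hTv⟩
    exact List.mem_map.mpr ⟨⟨T, hT⟩, Finset.mem_toList.mpr (Finset.mem_attach _ _), rfl⟩
  -- patch
  haveI : Algebra.EssFiniteType k K := inferInstance
  exact ProjModel.hasResolution_of_resolvingSystem (hZ K) M₀ l hlcov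

/-- **Weak resolution in every dimension over `k` from relative LU over `k` and two-model
patching over `k`** (reduction to the integral projective case by
`ResolutionOverUpToDim.of_projective`: components, Chow's lemma, projective closure).
[cite: Piltant2013, Prop. 5.1 and Cor. 5.7] -/
theorem resolutionOverUpToDim_of_twoModelPatching_of_relLU {k : Type u} [Field k]
    (hZ : ∀ (K : Type u) [Field K] [Algebra k K] [Algebra.EssFiniteType k K],
      ∀ M₁ M₂ : ProjModel k K,
        ∃ (N : ProjModel k K) (φ₁ : N.Hom M₁) (φ₂ : N.Hom M₂), φ₁.RegLe ∧ φ₂.RegLe)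
    (hLU : ∀ (K : Type u) [Field K] [Algebra k K] (O : ValuationSubring K) (R : Subalgebra k K),
      R.FG → IsFractionRing R K → R.toSubring ≤ O.toSubring →
        ∃ (A : Subalgebra k K) (h : A.toSubring ≤ O.toSubring), R ≤ A ∧ A.FG ∧
          IsRegularLocalRing (Localization.AtPrime
            (Ideal.comap (Subring.inclusion h) (IsLocalRing.maximalIdeal O))))
    (d : ℕ) : ResolutionOverUpToDim k d :=
  ResolutionOverUpToDim.of_projective fun _ X ι hι hint _ => by
    haveI := hι
    haveI := hint
    exact hasResolution_of_twoModelPatching_of_relLU hZ hLU X ι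

/-- **Resolution in characteristic `p` from relative LU in characteristic `p` and two-model
patching over fields of characteristic `p`** — the dimension-free content of Zariski's
programme; what the crux `PatchingRel` (stmt-ResolutionOfSingularities-0642) needs beyond its
antecedent `LUrel_p` is exactly the first hypothesis (Piltant 2013, Prop. 5.1 for `P = P_reg`,
open in dimension `≥ 4`: "All of these problems are open in dimension four or more", p. 2).
The LU hypothesis is taken in the shape of `LUrel_p` (finitely generated `K/k`, `k ⊆ O`,
arbitrary finitely generated `R ⊆ O`). [cite: Piltant2013, p. 2 and Prop. 5.1] -/
theorem resolutionInChar_of_twoModelPatching_of_relLU {p : ℕ}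
    (hZ : ∀ (k : Type) [Field k] [CharP k p] (K : Type) [Field K] [Algebra k K]
      [Algebra.EssFiniteType k K], ∀ M₁ M₂ : ProjModel k K,
        ∃ (N : ProjModel k K) (φ₁ : N.Hom M₁) (φ₂ : N.Hom M₂), φ₁.RegLe ∧ φ₂.RegLe)
    (hLU : ∀ (k K : Type) [Field k] [CharP k p] [Field K] [Algebra k K],
      (⊤ : IntermediateField k K).FG → ∀ O : ValuationSubring K,
        (∀ c : k, algebraMap k K c ∈ O) → ∀ R : Subalgebra k K, R.FG →
          R.toSubring ≤ O.toSubring →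
            ∃ (A : Subalgebra k K) (h : A.toSubring ≤ O.toSubring), R ≤ A ∧ A.FG ∧
              IsFractionRing A K ∧ IsRegularLocalRing (Localization.AtPrime
                (Ideal.comap (Subring.inclusion h) (IsLocalRing.maximalIdeal O)))) :
    ResolutionInChar.{0} p := by
  intro k _ _ X f hs hl hq hr
  haveI : QuasiCompact f := hq
  haveI : LocallyOfFiniteType f := hl
  haveI : CompactSpace X := QuasiCompact.compactSpace_of_compactSpace f
  obtain ⟨d, hd⟩ := exists_topologicalKrullDim_le_of_locallyOfFiniteType f
  have hLU' : ∀ (K : Type) [Field K] [Algebra k K] (O : ValuationSubring K) (R : Subalgebra k K),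
      R.FG → IsFractionRing R K → R.toSubring ≤ O.toSubring →
        ∃ (A : Subalgebra k K) (h : A.toSubring ≤ O.toSubring), R ≤ A ∧ A.FG ∧
          IsRegularLocalRing (Localization.AtPrime
            (Ideal.comap (Subring.inclusion h) (IsLocalRing.maximalIdeal O))) := by
    intro K _ _ O R hRfg hRfr hRO
    haveI : Algebra.FiniteType k R := R.fg_iff_finiteType.mp hRfg
    haveI : Algebra.EssFiniteType R K :=
      Algebra.EssFiniteType.of_isLocalization K (nonZeroDivisors R)
    have hKfg : (⊤ : IntermediateField k K).FG :=
      IntermediateField.fg_top_iff.mpr (Algebra.EssFiniteType.comp k R K)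
    obtain ⟨A, h, hle, hAfg, -, hreg⟩ :=
      hLU k K hKfg O (fun c => hRO (R.algebraMap_mem c)) R hRfg hRO
    exact ⟨A, h, hle, hAfg, hreg⟩
  exact resolutionOverUpToDim_of_twoModelPatching_of_relLU (hZ k) hLU' d X f hs hl hq hr hd

/-! ## Absolute local uniformization suffices

The resolving-system step consumes only ABSOLUTE (weak) local uniformization — for every
valuation ring `O ∋ k` of `K/k` SOME finitely generated model `T ⊆ O` with `Frac T = K`
regular at the centre (`IsLocallyUniformizable k K O`, `LocalUniformization.lean`;
Piltant 2013, Axiom 5: "For each k-valuation ring V/k of K, there exists a proper model X/k of K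
such that the center x_V ∈ X of V satisfies x_V ∈ Reg_P(X)") — not the relative form. So the
relative antecedent `LUrel_p` of crux `PatchingRel` and the absolute antecedent `LU_p` of the
superseded crux `Patching` (stmt-0561) reduce to the SAME open core, two-model patching.
-/

/-- **Resolution of an integral projective variety from two-model patching and ANY supply of
uniformizing affine models** (the common generalisation: the hypothesis `hunif` is the conclusion
shape of `exists_hasRegularCentre_of_relLU`; proof verbatim that of
`hasResolution_of_twoModelPatching_of_relLU`). [cite: Piltant2013, Prop. 5.1 and Cor. 5.7] -/
theorem hasResolution_of_twoModelPatching_of_uniformizable {k : Type u} [Field k]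
    (hZ : ∀ (K : Type u) [Field K] [Algebra k K] [Algebra.EssFiniteType k K],
      ∀ M₁ M₂ : ProjModel k K,
        ∃ (N : ProjModel k K) (φ₁ : N.Hom M₁) (φ₂ : N.Hom M₂), φ₁.RegLe ∧ φ₂.RegLe)
    (hunif : ∀ (K : Type u) [Field K] [Algebra k K] (A₀ : Subalgebra k K), A₀.FG →
      IsFractionRing A₀ K → ∀ v : ZariskiRiemannSpace k K, ∃ T : Subalgebra k K,
        (T.FG ∧ IsFractionRing T K) ∧ ZariskiRiemannSpace.HasRegularCentre T v)
    {n : ℕ} (X : Scheme.{u}) [IsIntegral X]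
    (ι : X ⟶ (Motives.projectiveSpace n k).left) [IsClosedImmersion ι] :
    Scheme.HasResolution X := by
  classical
  haveI : IsProper (Motives.projectiveSpace n k).hom := Motives.isProper_projectiveSpace n k
  let πX : X ⟶ Spec (.of k) := ι ≫ (Motives.projectiveSpace n k).hom
  have hproj : Motives.IsProjectiveOver (Over.mk πX) := ⟨n, Over.homMk ι rfl, ‹_›⟩
  haveI : LocallyOfFiniteType πX := inferInstance
  -- an affine chart `U = Spec A` of `X`
  obtain ⟨_, ⟨U', hU', rfl⟩, hηU, -⟩ := X.isBasis_affineOpens.exists_subset_of_mem_open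
    (Set.mem_univ (genericPoint X)) isOpen_univ
  let U : X.Opens := U'
  have hU : IsAffineOpen U := hU'
  haveI : IsAffine U := hU
  haveI : Nonempty U := ⟨⟨_, hηU⟩⟩
  let A : Type u := Γ(U, ⊤)
  -- `A` is a finitely generated `k`-algebra
  let g : (U : Scheme.{u}) ⟶ Spec (.of k) := U.ι ≫ πX
  let ψ : k →+* A := g.appTop.hom.comp (Scheme.ΓSpecIso (.of k)).inv.hom
  have hψ : ψ.FiniteType := by
    have h1 : g.appTop.hom.FiniteType :=
      (HasRingHomProperty.iff_of_isAffine (P := @LocallyOfFiniteType)).mp inferInstance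
    exact h1.comp (RingHom.FiniteType.of_surjective _
      (Scheme.ΓSpecIso (.of k)).symm.commRingCatIsoToRingEquiv.surjective)
  letI : Algebra k A := ψ.toAlgebra
  haveI hft : Algebra.FiniteType k A := hψ
  -- its fraction field `K`, and `X` as a projective model of `K/k`
  let K : Type u := FractionRing A
  let j : Spec (.of A) ⟶ X := U.toScheme.isoSpec.inv ≫ U.ι
  have hj : j ≫ πX = Spec.map (CommRingCat.ofHom (algebraMap k A)) := by
    change (U.toScheme.isoSpec.inv ≫ U.ι) ≫ πX = Spec.map (CommRingCat.ofHom ψ)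
    rw [Category.assoc, isoSpec_inv_comp]
    rfl
  let M₀ : ProjModel k K := ProjModel.ofChart (K := K) X πX hproj A j hj
  -- `A` as a subalgebra `A₀ ⊆ K`, finitely generated with `Frac A₀ = K`
  let toK : A →ₐ[k] K := IsScalarTower.toAlgHom k A K
  have htoK : Function.Injective toK := IsFractionRing.injective A K
  let A₀ : Subalgebra k K := toK.range
  have hA₀fg : A₀.FG := by
    rw [show A₀ = Subalgebra.map toK ⊤ from (Algebra.map_top toK).symm]
    exact Subalgebra.FG.map toK hft.out
  haveI hA₀fr : IsFractionRing A₀ K := by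
    refine IsFractionRing.of_field A₀ K fun z => ?_
    obtain ⟨a, b, -, rfl⟩ := IsFractionRing.div_surjective (A := A) z
    exact ⟨⟨algebraMap A K a, a, rfl⟩, ⟨algebraMap A K b, b, rfl⟩, rfl⟩
  -- a finite resolving system of affine models, from the uniformizability hypothesis
  have hcov : ∀ v : ZariskiRiemannSpace k K, ∃ T : Subalgebra k K,
      (T.FG ∧ IsFractionRing T K) ∧ ZariskiRiemannSpace.HasRegularCentre T v :=
    hunif K A₀ hA₀fg hA₀fr
  obtain ⟨𝒯, h𝒯, h𝒯cov⟩ := exists_finite_resolvingSystem' (P := fun T => IsFractionRing T K)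
    (fun T hT => (isJ2Ring_of_field k).2 T ((Subalgebra.fg_iff_finiteType T).mp hT)) hcov
  -- their projective closures: a finite resolving system of projective models
  have hM : ∀ T : ↥𝒯, ∃ M : ProjModel k K, ∀ w : ZariskiRiemannSpace k K,
      ZariskiRiemannSpace.HasRegularCentre T.1 w → M.RegCentre w := fun T => by
    haveI := (h𝒯 T.1 T.2).2
    exact ProjModel.exists_regCentre_of_hasRegularCentre T.1 (h𝒯 T.1 T.2).1
  choose M hM using hM
  let l : List (ProjModel k K) := 𝒯.attach.toList.map M
  have hlcov : ∀ v : ZariskiRiemannSpace k K, ∃ N ∈ l, N.RegCentre v := by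
    intro v
    obtain ⟨T, hT, hTv⟩ := h𝒯cov v
    refine ⟨M ⟨T, hT⟩, ?_, hM ⟨T, hT⟩ v hTv⟩
    exact List.mem_map.mpr ⟨⟨T, hT⟩, Finset.mem_toList.mpr (Finset.mem_attach _ _), rfl⟩
  -- patch
  haveI : Algebra.EssFiniteType k K := inferInstance
  exact ProjModel.hasResolution_of_resolvingSystem (hZ K) M₀ l hlcov

/-- **Absolute (weak) local uniformization uniformizes every valuation on a finitely generated
affine model**, trivially: it is the statement. Recorded in the resolving-system shape.
[cite: Piltant2013, Axiom 5] -/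
theorem exists_hasRegularCentre_of_lu {k K : Type u} [Field k] [Field K] [Algebra k K]
    (hLU : ∀ O : ValuationSubring K, (∀ c : k, algebraMap k K c ∈ O) →
      IsLocallyUniformizable k K O)
    (v : ZariskiRiemannSpace k K) :
    ∃ T : Subalgebra k K, (T.FG ∧ IsFractionRing T K) ∧
      ZariskiRiemannSpace.HasRegularCentre T v := by
  obtain ⟨T, hTO, hTfg, hTfr, hreg⟩ := hLU v.asValuationSubring v.algebraMap_mem
  exact ⟨T, ⟨hTfg, hTfr⟩, hTO, hreg⟩

/-- **Resolution in characteristic `p` from ABSOLUTE local uniformization in characteristic `p`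
(`LocalUniformizationInChar p`) and two-model patching over fields of characteristic `p`.**
Hence the relative strengthening of the antecedent in crux `PatchingRel` (stmt-0642) over the
absolute crux `Patching` (stmt-0561) is not used by Zariski's mechanism: both reduce to
two-model patching (Piltant 2013, Prop. 5.1 for `P = P_reg`), open in transcendence degree
`≥ 4`. [cite: Piltant2013, p. 2 and Prop. 5.1] -/
theorem resolutionInChar_of_twoModelPatching_of_lu {p : ℕ}
    (hZ : ∀ (k : Type) [Field k] [CharP k p] (K : Type) [Field K] [Algebra k K]
      [Algebra.EssFiniteType k K], ∀ M₁ M₂ : ProjModel k K,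
        ∃ (N : ProjModel k K) (φ₁ : N.Hom M₁) (φ₂ : N.Hom M₂), φ₁.RegLe ∧ φ₂.RegLe)
    (hLU : LocalUniformizationInChar.{0} p) : ResolutionInChar.{0} p := by
  intro k _ _ X f hs hl hq hr
  haveI : QuasiCompact f := hq
  haveI : LocallyOfFiniteType f := hl
  haveI : CompactSpace X := QuasiCompact.compactSpace_of_compactSpace f
  obtain ⟨d, hd⟩ := exists_topologicalKrullDim_le_of_locallyOfFiniteType f
  have hU : ∀ (K : Type) [Field K] [Algebra k K] (A₀ : Subalgebra k K), A₀.FG →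
      IsFractionRing A₀ K → ∀ v : ZariskiRiemannSpace k K, ∃ T : Subalgebra k K,
        (T.FG ∧ IsFractionRing T K) ∧ ZariskiRiemannSpace.HasRegularCentre T v := by
    intro K _ _ A₀ hA₀fg hA₀fr v
    haveI : Algebra.FiniteType k A₀ := A₀.fg_iff_finiteType.mp hA₀fg
    haveI : Algebra.EssFiniteType A₀ K :=
      Algebra.EssFiniteType.of_isLocalization K (nonZeroDivisors A₀)
    have hKfg : (⊤ : IntermediateField k K).FG :=
      IntermediateField.fg_top_iff.mpr (Algebra.EssFiniteType.comp k A₀ K)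
    exact exists_hasRegularCentre_of_lu (fun O hO => hLU k K hKfg O hO) v
  refine ResolutionOverUpToDim.of_projective (k := k) (d := d) (fun _ Y ι hι hint _ => ?_)
    X f hs hl hq hr hd
  haveI := hι
  haveI := hint
  exact hasResolution_of_twoModelPatching_of_uniformizable (hZ k) hU Y ι

end Literature.AlgebraicGeometry.Resolution

end
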